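import Mathlib.Analysis.SpecialFunctions.Gaussian.GaussianIntegral
import Mathlib.MeasureTheory.Integral.DominatedConvergence
import Literature.NumberTheory.EllipticCurves.EisensteinValuesAtI
import HarnessLib

/-!
# Hurwitz's lattice sum `∑′ (mi + n)⁻⁴ = Γ(¼)⁸/(960π²)` in real form, and the Mellin transform of
# the Glaisher theta series `∑ (m⁴ − 6m²n² + n⁴) e^{−π(m²+n²)σ}`

Topic `Literature/Analysis/SpecialFunctions`. Two bookkeeping results, both PROVED (no definitions,
no named facts), feeding the evaluation of the cubic moment `∫₀¹K(k′)³dk` (Zhou 2013, Prop. 5.1):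

* `tsum_eisSummand_four_I`, **`hurwitz_latticeSum_re`** — Hurwitz's evaluation (1899) of the
  weight-4 Eisenstein series of the Gaussian lattice, `∑_{(m,n)≠0} (mi + n)⁻⁴ = Γ(¼)⁸/(960π²)`
  (`= ϖ⁴/15`), read off the tree's `g₂(ℤi + ℤ) = Γ(¼)⁸/(16π²)`
  (`Literature.NumberTheory.EllipticCurves.GaussianLattice.g₂_eq_Gamma`, with Mathlib's
  `g₂ = 60 G₄` and the tree's `G_ofUpperHalfPlane`), and its real form
  `∑_{(m,n)∈ℤ²} (m⁴ − 6m²n² + n⁴)/(m² + n²)⁴ = Γ(¼)⁸/(960π²)` (`Re (mi+n)⁻⁴ = Re(n − mi)⁴/(m²+n²)⁴`;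
  the term at the origin is `0` on both sides);
* **`integral_Ioi_pow_three_mul_glaisherTheta`** — the Mellin transform at `s = 4`:
  `∫₀^∞ σ³ ∑_{(m,n)} (m⁴−6m²n²+n⁴) e^{−π(m²+n²)σ} dσ = (6/π⁴) ∑_{(m,n)} (m⁴−6m²n²+n⁴)/(m²+n²)⁴`
  (termwise `∫₀^∞ σ³e^{−πNσ}dσ = 6/(πN)⁴`; the interchange is justified by
  `|m⁴−6m²n²+n⁴| ≤ 3(m²+n²)²` and the absolute convergence of `∑′|mi+n|⁻⁴`, Mathlib's
  `EisensteinSeries.summable_norm_eisSummand`).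

## References

* A. Hurwitz, *Über die Entwicklungskoeffizienten der lemniskatischen Funktionen*, Math. Ann. 51
  (1899) 196–226, §1.
* [RogersWanZucker2013] M. Rogers, J. G. Wan, I. J. Zucker, Ramanujan J. 37 (2015) 113–130,
  arXiv:1303.2259, §3 (Mellin transforms of `∑(n − im)⁴q^{n²+m²}`, eq. (18)).
-/

noncomputable section

open Real Complex _root_.MeasureTheory _root_.Set _root_.Filter
open scoped Real _root_.Topology

namespace Literature.Analysis.SpecialFunctions

open EisensteinSeries

/-! ### Hurwitz's lattice sum -/

/-- **Hurwitz (1899): `∑_{(m,n)≠0} (mi + n)⁻⁴ = Γ(¼)⁸/(960π²)`** — the full weight-4 Eisenstein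
series of the Gaussian lattice `ℤi + ℤ` (`= G₄(Λ_i) = g₂(Λ_i)/60`; the summand at `(0,0)` is `0`).
[folklore] -/
theorem tsum_eisSummand_four_I :
    ∑' v : Fin 2 → ℤ, eisSummand 4 v UpperHalfPlane.I =
      (Real.Gamma (1 / 4) : ℂ) ^ 8 / (960 * (π : ℂ) ^ 2) := by
  have hg := Literature.NumberTheory.EllipticCurves.GaussianLattice.g₂_eq_Gamma
  rw [PeriodPair.g₂, PeriodPair.G_ofUpperHalfPlane] at hg
  have h : ∑' v : Fin 2 → ℤ, eisSummand ((4 : ℕ) : ℤ) v UpperHalfPlane.I =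
      (Real.Gamma (1 / 4) : ℂ) ^ 8 / (960 * (π : ℂ) ^ 2) := by
    have hπ : (π : ℂ) ≠ 0 := Complex.ofReal_ne_zero.mpr Real.pi_ne_zero
    field_simp at hg
    field_simp
    linear_combination hg
  exact_mod_cast h

/-- The weight-4 summand at `τ = i` in coordinates: `(mi + n)⁻⁴`. [folklore] -/
theorem eisSummand_four_I (v : Fin 2 → ℤ) :
    eisSummand 4 v UpperHalfPlane.I = (((v 0 : ℂ) * I + v 1) ^ 4)⁻¹ := by
  rw [eisSummand, UpperHalfPlane.coe_I, zpow_neg, show ((4 : ℤ)) = ((4 : ℕ) : ℤ) from rfl, zpow_natCast]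

/-- `Re (mi + n)⁻⁴ = (m⁴ − 6m²n² + n⁴)/(m² + n²)⁴` (also at `(m,n) = (0,0)`, where both sides are
`0`). [folklore] -/
theorem re_inv_pow_four (m n : ℤ) :
    ((((m : ℂ) * I + n) ^ 4)⁻¹).re =
      ((m : ℝ) ^ 4 - 6 * (m : ℝ) ^ 2 * (n : ℝ) ^ 2 + (n : ℝ) ^ 4) / ((m : ℝ) ^ 2 + (n : ℝ) ^ 2) ^ 4 := by
  have hexp : ((m : ℂ) * I + n) ^ 4 =
      (((m : ℝ) ^ 4 - 6 * (m : ℝ) ^ 2 * (n : ℝ) ^ 2 + (n : ℝ) ^ 4 : ℝ) : ℂ) +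
        ((4 * (m : ℝ) * (n : ℝ) ^ 3 - 4 * (m : ℝ) ^ 3 * (n : ℝ) : ℝ) : ℂ) * I := by
    push_cast
    linear_combination ((m : ℂ) ^ 4 * (I ^ 2 - 1) + 4 * (m : ℂ) ^ 3 * n * I + 6 * (m : ℂ) ^ 2 * (n : ℂ) ^ 2) * I_sq
  have hns : Complex.normSq (((m : ℂ) * I + n) ^ 4) = (((m : ℝ) ^ 2 + (n : ℝ) ^ 2) ^ 4) := by
    rw [map_pow, show ((m : ℂ) * I + n) = ((n : ℝ) : ℂ) + ((m : ℝ) : ℂ) * I by push_cast; ring,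
      Complex.normSq_add_mul_I]
    ring
  rw [Complex.inv_re, hns, hexp, Complex.add_re, Complex.ofReal_re, Complex.re_ofReal_mul, Complex.I_re,
    mul_zero, add_zero]

/-- Reindexing `Fin 2 → ℤ` by `ℤ × ℤ`. [folklore] -/
theorem tsum_finTwoArrow_eq_tsum_prod {α : Type*} [AddCommMonoid α] [TopologicalSpace α]
    (f : ℤ → ℤ → α) :
    ∑' v : Fin 2 → ℤ, f (v 0) (v 1) = ∑' p : ℤ × ℤ, f p.1 p.2 := by
  rw [← (finTwoArrowEquiv ℤ).symm.tsum_eq]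
  rfl

/-- The norms `‖(mi+n)⁻⁴‖` are summable over `ℤ × ℤ` (Mathlib's Eisenstein summability,
reindexed). [folklore] -/
theorem summable_norm_inv_pow_four :
    Summable fun p : ℤ × ℤ => ‖((((p.1 : ℂ) * I + p.2) ^ 4)⁻¹)‖ := by
  have h := summable_norm_eisSummand (by norm_num : (3 : ℤ) ≤ 4) UpperHalfPlane.I
  rw [← (finTwoArrowEquiv ℤ).symm.summable_iff] at h
  refine h.congr (fun p => ?_)
  simp only [Function.comp, eisSummand_four_I]
  rfl

/-- **Hurwitz's lattice sum, real form**: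
`∑_{(m,n)∈ℤ²} (m⁴ − 6m²n² + n⁴)/(m² + n²)⁴ = Γ(¼)⁸/(960π²)`. [folklore] -/
theorem hurwitz_latticeSum_re :
    ∑' p : ℤ × ℤ, ((p.1 : ℝ) ^ 4 - 6 * (p.1 : ℝ) ^ 2 * (p.2 : ℝ) ^ 2 + (p.2 : ℝ) ^ 4) /
        ((p.1 : ℝ) ^ 2 + (p.2 : ℝ) ^ 2) ^ 4 =
      Real.Gamma (1 / 4) ^ 8 / (960 * π ^ 2) := by
  have h := tsum_eisSummand_four_I
  simp_rw [eisSummand_four_I] at h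
  rw [tsum_finTwoArrow_eq_tsum_prod (fun m n => (((m : ℂ) * I + n) ^ 4)⁻¹)] at h
  have hre := congrArg Complex.re h
  rw [Complex.re_tsum summable_norm_inv_pow_four.of_norm] at hre
  simp_rw [re_inv_pow_four] at hre
  rw [hre]
  have : ((Real.Gamma (1 / 4) : ℂ) ^ 8 / (960 * (π : ℂ) ^ 2)) =
      ((Real.Gamma (1 / 4) ^ 8 / (960 * π ^ 2) : ℝ) : ℂ) := by push_cast; ring
  rw [this, Complex.ofReal_re]

/-! ### The Mellin transform of the Glaisher theta series at `s = 4` -/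

/-- `∫₀^∞ σ³ e^{−rσ} dσ = 6/r⁴` for `r > 0`. [folklore] -/
theorem integral_Ioi_pow_three_mul_exp_neg_mul {r : ℝ} (hr : 0 < r) :
    ∫ σ in Ioi (0 : ℝ), σ ^ 3 * rexp (-(r * σ)) = 6 / r ^ 4 := by
  have h := integral_rpow_mul_exp_neg_mul_Ioi (by norm_num : (0 : ℝ) < 4) hr
  have h4 : Real.Gamma 4 = 6 := by
    rw [show (4 : ℝ) = (3 : ℕ) + 1 by norm_num, Real.Gamma_nat_eq_factorial]
    norm_num [Nat.factorial]
  rw [h4, show (4 : ℝ) - 1 = ((3 : ℕ) : ℝ) by norm_num] at h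
  rw [show (1 / r) ^ (4 : ℝ) = (1 / r) ^ ((4 : ℕ) : ℝ) by norm_num] at h
  simp_rw [Real.rpow_natCast] at h
  rw [h]
  field_simp

/-- `σ³ e^{−rσ}` is integrable on `(0,∞)` for `r > 0`. [folklore] -/
theorem integrableOn_pow_three_mul_exp_neg_mul {r : ℝ} (hr : 0 < r) :
    IntegrableOn (fun σ : ℝ => σ ^ 3 * rexp (-(r * σ))) (Ioi 0) := by
  have h := integrableOn_rpow_mul_exp_neg_mul_rpow (by norm_num : (-1 : ℝ) < 3) le_rfl hr
  refine (integrableOn_congr_fun (fun σ hσ => ?_) measurableSet_Ioi).mp h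
  have hσ' : (0 : ℝ) ≤ σ := le_of_lt hσ
  rw [Real.rpow_one, show (3 : ℝ) = ((3 : ℕ) : ℝ) by norm_num, Real.rpow_natCast]
  ring_nf

/-- `|m⁴ − 6m²n² + n⁴| ≤ 3(m² + n²)²`. [folklore] -/
theorem abs_glaisherWeight_le (m n : ℝ) :
    |m ^ 4 - 6 * m ^ 2 * n ^ 2 + n ^ 4| ≤ 3 * (m ^ 2 + n ^ 2) ^ 2 := by
  rw [abs_le]
  constructor <;> nlinarith [sq_nonneg m, sq_nonneg n, mul_nonneg (sq_nonneg m) (sq_nonneg n),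
    sq_nonneg (m ^ 2), sq_nonneg (n ^ 2)]

/-- `‖(mi+n)⁻⁴‖ = 1/(m²+n²)²`. [folklore] -/
theorem norm_inv_pow_four (m n : ℤ) :
    ‖((((m : ℂ) * I + n) ^ 4)⁻¹)‖ = 1 / ((m : ℝ) ^ 2 + (n : ℝ) ^ 2) ^ 2 := by
  rw [norm_inv, norm_pow, show ((m : ℂ) * I + n) = ((n : ℝ) : ℂ) + ((m : ℝ) : ℂ) * I by push_cast; ring,
    Complex.norm_add_mul_I, show (4 : ℕ) = 2 * 2 from rfl, pow_mul, Real.sq_sqrt (by positivity), one_div]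
  congr 1
  ring

/-- **Mellin transform of the Glaisher theta series at `s = 4`**:
`∫₀^∞ σ³ ∑_{(m,n)∈ℤ²} (m⁴−6m²n²+n⁴) e^{−π(m²+n²)σ} dσ = (6/π⁴) ∑_{(m,n)} (m⁴−6m²n²+n⁴)/(m²+n²)⁴`
(the inner series written with the weight outside the `σ`-dependent factor; termwise
`∫₀^∞σ³e^{−πNσ}dσ = 6/(πN)⁴`, interchange by absolute convergence). [cite: RogersWanZucker2013, §3 eq. (18)] -/
theorem integral_Ioi_pow_three_mul_glaisherTheta :
    ∫ σ in Ioi (0 : ℝ), ∑' p : ℤ × ℤ, ((p.1 : ℝ) ^ 4 - 6 * (p.1 : ℝ) ^ 2 * (p.2 : ℝ) ^ 2 + (p.2 : ℝ) ^ 4) *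
        (σ ^ 3 * rexp (-(π * ((p.1 : ℝ) ^ 2 + (p.2 : ℝ) ^ 2) * σ))) =
      6 / π ^ 4 * ∑' p : ℤ × ℤ, ((p.1 : ℝ) ^ 4 - 6 * (p.1 : ℝ) ^ 2 * (p.2 : ℝ) ^ 2 + (p.2 : ℝ) ^ 4) /
        ((p.1 : ℝ) ^ 2 + (p.2 : ℝ) ^ 2) ^ 4 := by
  -- the terms and their integrals
  set w : ℤ × ℤ → ℝ := fun p => (p.1 : ℝ) ^ 4 - 6 * (p.1 : ℝ) ^ 2 * (p.2 : ℝ) ^ 2 + (p.2 : ℝ) ^ 4 with hw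
  set N : ℤ × ℤ → ℝ := fun p => (p.1 : ℝ) ^ 2 + (p.2 : ℝ) ^ 2 with hN
  have hN0 : ∀ p : ℤ × ℤ, p ≠ 0 → 0 < N p := by
    intro p hp
    simp only [hN]
    rcases p with ⟨m, n⟩
    have : m ≠ 0 ∨ n ≠ 0 := by
      by_contra h
      simp only [not_or, ne_eq, not_not] at h
      exact hp (Prod.ext h.1 h.2)
    rcases this with h | h
    · have : (m : ℝ) ≠ 0 := Int.cast_ne_zero.mpr h
      positivity
    · have : (n : ℝ) ≠ 0 := Int.cast_ne_zero.mpr h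
      positivity
  have hw0 : w 0 = 0 := by simp [hw]
  -- termwise integral
  have hterm : ∀ p : ℤ × ℤ, ∫ σ in Ioi (0 : ℝ), w p * (σ ^ 3 * rexp (-(π * N p * σ))) =
      6 / π ^ 4 * (w p / N p ^ 4) := by
    intro p
    by_cases hp : p = 0
    · subst hp
      simp [hw0]
    · have hr : 0 < π * N p := mul_pos Real.pi_pos (hN0 p hp)
      rw [integral_const_mul, integral_Ioi_pow_three_mul_exp_neg_mul hr]
      have hNp : N p ≠ 0 := (hN0 p hp).ne'
      have hπ : π ≠ 0 := Real.pi_pos.ne'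
      field_simp
  -- integrability of each term
  have hint : ∀ p : ℤ × ℤ, Integrable (fun σ : ℝ => w p * (σ ^ 3 * rexp (-(π * N p * σ))))
      (volume.restrict (Ioi 0)) := by
    intro p
    by_cases hp : p = 0
    · subst hp
      simp [hw0]
    · exact ((integrableOn_pow_three_mul_exp_neg_mul (mul_pos Real.pi_pos (hN0 p hp))).const_mul _)
  -- summability of the integrated norms: `∫‖F p‖ = |w| 6/(πN)⁴ ≤ (18/π⁴)/N²`
  have hnorm : ∀ p : ℤ × ℤ, ∫ σ in Ioi (0 : ℝ), ‖w p * (σ ^ 3 * rexp (-(π * N p * σ)))‖ =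
      |w p| * ∫ σ in Ioi (0 : ℝ), σ ^ 3 * rexp (-(π * N p * σ)) := by
    intro p
    rw [← integral_const_mul]
    refine setIntegral_congr_fun measurableSet_Ioi (fun σ hσ => ?_)
    rw [norm_mul, Real.norm_eq_abs, Real.norm_eq_abs]
    congr 1
    exact abs_of_nonneg (mul_nonneg (pow_nonneg (le_of_lt hσ) 3) (Real.exp_pos _).le)
  have hsum : Summable fun p : ℤ × ℤ => ∫ σ in Ioi (0 : ℝ), ‖w p * (σ ^ 3 * rexp (-(π * N p * σ)))‖ := by
    refine Summable.of_nonneg_of_le (fun p => integral_nonneg (fun σ => norm_nonneg _))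
      (fun p => ?_) ((summable_norm_inv_pow_four).mul_left (18 / π ^ 4))
    rw [hnorm p, norm_inv_pow_four]
    by_cases hp : p = 0
    · subst hp
      simp [hw0]
    · have hNp := hN0 p hp
      rw [integral_Ioi_pow_three_mul_exp_neg_mul (mul_pos Real.pi_pos hNp)]
      have hwle : |w p| ≤ 3 * N p ^ 2 := abs_glaisherWeight_le _ _
      have hπ4 : 0 < π ^ 4 := by positivity
      rw [show |w p| * (6 / (π * N p) ^ 4) = (6 / π ^ 4) * (|w p| / N p ^ 4) by
        rw [mul_pow]; field_simp]
      rw [show 18 / π ^ 4 * (1 / ((p.1 : ℝ) ^ 2 + (p.2 : ℝ) ^ 2) ^ 2) = (6 / π ^ 4) * (3 / N p ^ 2) by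
        simp only [hN]; ring]
      refine mul_le_mul_of_nonneg_left ?_ (by positivity)
      rw [div_le_div_iff₀ (by positivity) (by positivity)]
      nlinarith [hwle, pow_pos hNp 2]
  -- interchange
  rw [← integral_tsum_of_summable_integral_norm hint hsum, ← tsum_mul_left]
  exact tsum_congr hterm

end Literature.Analysis.SpecialFunctions

end
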